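import Summits.Ventures.YMGap.RobustBall.AreaLawRadiusPair
import Summits.Ventures.YMGap.RobustBall.AreaLawRowsPairW
import HarnessLib

/-!
# Venture YMGap, track Y2 ROBUST-BALL — AREA-LAW RADIUS FUNCTIONS ON THE TIER-2 (diameter-weighted) BALL through the pair slab door:
# every `SU(N)` hypothesis-free (closed form at every coupling and every weight), and the `SU(3)` certified pairs (affine in `β_W`, `κ = log 6/5`)

HONEST FRAMING.  Venture file of the cell `pub-ymgap` (QuantumFields programme), seat engine-2 (g7).  Strong-coupling LATTICE statements only
(`RobustBall.AreaLawOnBallW N d β κ ε₀ ε₁ mv`: Wilson's area law for rectangular loops on the tori `(ℤ/L)^d`, constants uniform in `L` and over the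
tier-2 ball `ClusterDomain κ ε₀ ε₁ ∩ IsSlabLocal mv` — INFINITE horizontal range, loads weighted `e^{κ·diam}`, vertical window `mv`); nothing about the
continuum, a mass gap, weak coupling, or Clay.  The tier-2 twins of `AreaLawRadiusPair`:

1. **Every `N ≥ 2`, every `d = n + 1`, every weight `κ > 0`, HYPOTHESIS-FREE — a closed-form radius.**  ds-4's weighted all-`N` pair schema
   `suN_areaLawOnBallW_bakryEmery` has the row condition `e^{κ/n}·e^{ε₀} q + e^{ε₀/2} ε₁/√(N D) < 1` (`q = R/D`, `R = 2n|β_tH|`, `D = 1/2 − R`).  For any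
   majorant `w ≥ e^{κ/n}` with `Q := w·q < 1` the one-parameter ball of radius `ε = (1 − Q)/4` satisfies it (certificate `bePairW_radius_cert`, the same
   Positivstellensatz polynomial `1 − δ/8 − (5/32)δ² − (29/128)δ³` as the tier-1 case, `δ = 1 − Q`): `suN_areaLawOnBallW_radius`.  So the tier-2 ball has a
   positive radius at EVERY coupling and EVERY weight inside the weighted window `e^{κ/n} R/(1/2 − R) < 1`, for every `N` at once; e.g. `κ = n·log(6/5)`
   (`w = 6/5`): window `R < 5/22`.
2. **`SU(3)`, `d = 4` and `d = 3`, `κ = log(6/5)`, GIVEN the certified pairs — AFFINE radius functions** under the tier-2 cells of `AreaLawRowsPairW`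
   (nlinarith certificates, weight majorants `(6/5)^{1/3} ≤ 1.0627`, `(6/5)^{1/2} ≤ 1.0955`): P11 (H1, H2) `ε(β_W) = 0.45 − β_W/2` on `0 ≤ β_W ≤ 11/20`
   (`d = 4`; cells `.370/.312/.241/.214/.188` at `1/4, 1/3, 9/20, 1/2, 11/20`) and `0.45 − β_W/3` on `[0, 33/40]` (`d = 3`); P35 (H1, H2′) `ε(β_W) = 0.35 − 0.42β_W`
   on `0 ≤ β_W ≤ 5/6` (`d = 4`, vanishing at `5/6`, just inside the weighted door's threshold `≈ 0.856`) and `0.33 − 0.27β_W` on `[0, 6/5]` (`d = 3`).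
   NOTHING asserted about H1 `OneLinkPoincareSUN 3 (3/5) (4/5)`, H2 `OneLinkVarianceBound 3 (11/30) (49/20)`, H2′ `OneLinkVarianceBound 3 (3/5) (17/5)`
   (classes «K × C(H1) × C-iv(H2)» resp. «K × C(H1) × C-iv(H2′)» after the E4 second leg of 2026-08-23).
-/

noncomputable section

open MeasureTheory ProbabilityTheory Real
open Literature.MathematicalPhysics.QuantumFieldTheory
open Summit.QuantumFields.BalabanUV.InfraRed.StrongCouplingPoincareDoorSUN (OneLinkPoincareSUN)
open Summit.QuantumFields.BalabanUV.InfraRed.StrongCouplingVarianceDoorSUN (OneLinkVarianceBound)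
open Summit.Ventures.YMGap.RobustBall
  (AreaLawOnBallW suN_areaLawOnBallW_bakryEmery exp_log_six_fifths_div_three_le exp_log_six_fifths_div_two_le)

namespace Summit.Ventures.YMGap.RobustBallPair

variable {N n : ℕ}

/-! ### 1. Every `N ≥ 2`, every weight: a positive radius at every coupling of the weighted Bakry–Émery pair window -/

/-- **The weighted radius certificate**, in the weighted row value `Q = w·R/(1/2 − R)`: for `0 ≤ Q < 1`, `X ≥ 4/9` and `ε = (1 − Q)/4`,
`e^{2ε} Q + e^{2ε/2} ε/√X < 1` (`Q = 1 − δ`, `e^{x} ≤ 1 + x + x²`, `1/√X ≤ 3/2`, `1 − δ/8 − (5/32)δ² − (29/128)δ³ < 1`). [folklore] -/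
theorem bePairW_radius_cert {Q X : ℝ} (hQ0 : 0 ≤ Q) (hQ : Q < 1) (hX : 4 / 9 ≤ X) :
    exp (2 * ((1 - Q) / 4)) * Q + exp (2 * ((1 - Q) / 4) / 2) * ((1 - Q) / 4) / Real.sqrt X < 1 := by
  set δ : ℝ := 1 - Q with hδdef
  have hδ0 : 0 < δ := by rw [hδdef]; linarith
  have hδ1 : δ ≤ 1 := by rw [hδdef]; linarith
  have hq : Q = 1 - δ := by rw [hδdef]; ring
  rw [show 2 * (δ / 4) / 2 = δ / 4 by ring, show 2 * (δ / 4) = δ / 2 by ring, hq]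
  have hE2 := exp_le_one_add_add_sq (x := δ / 2) (by linarith) (by linarith)
  have hE1 := exp_le_one_add_add_sq (x := δ / 4) (by linarith) (by linarith)
  have hXs : 2 / 3 ≤ Real.sqrt X := by
    rw [show (2 / 3 : ℝ) = Real.sqrt ((2 / 3) ^ 2) by rw [Real.sqrt_sq (by norm_num)]]
    exact Real.sqrt_le_sqrt (by linarith)
  have hXpos : 0 < Real.sqrt X := lt_of_lt_of_le (by norm_num) hXs
  have h2 : exp (δ / 4) * (δ / 4) / Real.sqrt X ≤ (1 + δ / 4 + (δ / 4) ^ 2) * (δ / 4) * (3 / 2) := by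
    rw [div_le_iff₀ hXpos]
    calc exp (δ / 4) * (δ / 4) ≤ (1 + δ / 4 + (δ / 4) ^ 2) * (δ / 4) := mul_le_mul_of_nonneg_right hE1 (by linarith)
      _ = (1 + δ / 4 + (δ / 4) ^ 2) * (δ / 4) * (3 / 2) * (2 / 3) := by ring
      _ ≤ (1 + δ / 4 + (δ / 4) ^ 2) * (δ / 4) * (3 / 2) * Real.sqrt X :=
          mul_le_mul_of_nonneg_left hXs (by positivity)
  have h1 : exp (δ / 2) * (1 - δ) ≤ (1 + δ / 2 + (δ / 2) ^ 2) * (1 - δ) := mul_le_mul_of_nonneg_right hE2 (by linarith)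
  have hpoly : (1 + δ / 2 + (δ / 2) ^ 2) * (1 - δ) + (1 + δ / 4 + (δ / 4) ^ 2) * (δ / 4) * (3 / 2) < 1 := by
    nlinarith [pow_pos hδ0 2, pow_pos hδ0 3]
  linarith

/-- **EVERY `N ≥ 2`, every `d = n + 1`, every weight `κ > 0`, HYPOTHESIS-FREE — A POSITIVE TIER-2 AREA-LAW RADIUS AT EVERY COUPLING OF THE WEIGHTED
WINDOW.**  With `R = 2n|β_tH|` (`< 1/4`), a majorant `w ≥ e^{κ/n}`, the weighted row value `Q = w·R/(1/2 − R) < 1` and `ε = (1 − Q)/4 > 0`: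
`AreaLawOnBallW N (n+1) (N β_tH) κ (2ε) ε mv` for every vertical window `mv ≥ 1` — no range cut-off (ds-4's `suN_areaLawOnBallW_bakryEmery` on the tree's
Bakry–Émery pair; `N D ≥ 4/9`).  E.g. `κ = n·log(6/5)`: `w = 6/5`, window `R < 5/22`. [cite: arXiv220412737, Lemma 4.1 and Rem. 1.3] -/
theorem suN_areaLawOnBallW_radius (hN : 2 ≤ N) (hn : 1 ≤ n) {βt κ w : ℝ} (hκ : 0 < κ) (hw : exp (κ / n) ≤ w)
    (hb : |βt| * (2 * (n : ℝ)) < 1 / 4) (hQ : w * (|βt| * (2 * (n : ℝ))) / (1 / 2 - |βt| * (2 * (n : ℝ))) < 1) {mv : ℕ} (hmv : 1 ≤ mv) :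
    AreaLawOnBallW N (n + 1) ((N : ℝ) * βt) κ
      (2 * ((1 - w * (|βt| * (2 * (n : ℝ))) / (1 / 2 - |βt| * (2 * (n : ℝ)))) / 4))
      ((1 - w * (|βt| * (2 * (n : ℝ))) / (1 / 2 - |βt| * (2 * (n : ℝ)))) / 4) mv := by
  set R : ℝ := |βt| * (2 * (n : ℝ)) with hRdef
  set Q : ℝ := w * R / (1 / 2 - R) with hQdef
  have hR0 : 0 ≤ R := by positivity
  have hD : 0 < 1 / 2 - R := by linarith
  have hw1 : 1 ≤ w := le_trans (Real.one_le_exp (div_nonneg hκ.le (Nat.cast_nonneg n))) hw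
  have hw0 : 0 ≤ w := le_trans zero_le_one hw1
  have hQ0 : 0 ≤ Q := by rw [hQdef]; exact div_nonneg (mul_nonneg hw0 hR0) hD.le
  have hN2 : (2 : ℝ) ≤ N := by exact_mod_cast hN
  have hX : 4 / 9 ≤ (N : ℝ) * (1 / 2 - R) := by nlinarith
  have hcert := bePairW_radius_cert hQ0 hQ hX
  refine suN_areaLawOnBallW_bakryEmery (n := n) hN hn hκ (by linarith) hmv ?_
  -- replace `e^{κ/n}` by its majorant `w` in the first summand
  have hε0 : 0 ≤ (1 - Q) / 4 := by linarith
  have hfirst : exp (κ / n) * (exp (2 * ((1 - Q) / 4)) * R / (1 / 2 - R)) ≤ exp (2 * ((1 - Q) / 4)) * Q := by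
    have e : exp (2 * ((1 - Q) / 4)) * Q = w * (exp (2 * ((1 - Q) / 4)) * R / (1 / 2 - R)) := by
      rw [hQdef]; field_simp
    rw [e]
    exact mul_le_mul_of_nonneg_right hw (by positivity)
  linarith

/-- The `SU(3)`, `d = 4`, `κ = log(6/5)` reading in Wilson units (`R = 2β_W/3`, `w = 1.0627 ≥ (6/5)^{1/3}`): for `0 ≤ β_W` with
`Q = 1.0627·(2β_W/3)/(1/2 − 2β_W/3) < 1` (i.e. `β_W < 0.3636…`), `AreaLawOnBallW 3 4 (β_W/3) (log(6/5)) (2ε) ε mv` with `ε = (1 − Q)/4` — HYPOTHESIS-FREE.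
[folklore] -/
theorem su3_areaLawOnBallW_radius_bePair {βW : ℝ} (hβ : 0 ≤ βW) (hlt : βW < 3 / 8)
    (hQ : 1.0627 * (2 * βW / 3) / (1 / 2 - 2 * βW / 3) < 1) {mv : ℕ} (hmv : 1 ≤ mv) :
    AreaLawOnBallW 3 4 (βW / 3) (Real.log (6 / 5)) (2 * ((1 - 1.0627 * (2 * βW / 3) / (1 / 2 - 2 * βW / 3)) / 4))
      ((1 - 1.0627 * (2 * βW / 3) / (1 / 2 - 2 * βW / 3)) / 4) mv := by
  have habs : |βW / 9| * (2 * ((3 : ℕ) : ℝ)) = 2 * βW / 3 := by rw [abs_of_nonneg (by positivity)]; push_cast; ring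
  have hw : exp (Real.log (6 / 5) / ((3 : ℕ) : ℝ)) ≤ 1.0627 := by
    have h := exp_log_six_fifths_div_three_le; push_cast at h ⊢; norm_num at h ⊢; exact h
  have h := suN_areaLawOnBallW_radius (N := 3) (n := 3) (by norm_num) (by norm_num) (βt := βW / 9) (Real.log_pos (by norm_num)) hw
    (by rw [habs]; linarith) (by rw [habs]; exact hQ) hmv
  rw [habs] at h
  have e1 : ((3 : ℕ) : ℝ) * (βW / 9) = βW / 3 := by push_cast; ring
  rw [e1] at h
  exact h

/-! ### 2. `SU(3)`, `κ = log(6/5)`: AFFINE tier-2 radius functions on the certified pairs (Positivstellensatz certificates) -/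

/-- **`SU(3)`, `d = 4`, TIER 2 (`κ = log 6/5`), GIVEN H1, H2: AFFINE RADIUS `ε(β_W) = 0.45 − β_W/2` on the whole range `0 ≤ β_W ≤ 11/20`** —
`AreaLawOnBallW 3 4 (β_W/3) (log(6/5)) (2ε(β_W)) ε(β_W) mv` for every window `mv ≥ 1` (weighted pair door on P11; certificate max `0.961`). [folklore] -/
theorem su3_areaLawOnBallW_affineRadius_w65 (hP : OneLinkPoincareSUN 3 (3 / 5) (4 / 5)) (hV : OneLinkVarianceBound 3 (11 / 30) (49 / 20))
    {βW : ℝ} (hβ0 : 0 ≤ βW) (hβ : βW ≤ 11 / 20) {mv : ℕ} (hmv : 1 ≤ mv) :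
    AreaLawOnBallW 3 4 (βW / 3) (Real.log (6 / 5)) (2 * (9 / 20 - βW / 2)) (9 / 20 - βW / 2) mv :=
  su3_hsRowW4 hmv hP hV hβ0 hβ (Real.log_pos (by norm_num)) exp_log_six_fifths_div_three_le (by linarith) (by linarith)
    (by nlinarith [mul_nonneg hβ0 (sub_nonneg.2 hβ), pow_nonneg hβ0 2, pow_nonneg hβ0 3, mul_nonneg (pow_nonneg hβ0 2) (sub_nonneg.2 hβ),
      mul_nonneg (pow_nonneg hβ0 3) (sub_nonneg.2 hβ), pow_nonneg hβ0 4, mul_nonneg (pow_nonneg hβ0 4) (sub_nonneg.2 hβ)])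

/-- **`SU(3)`, `d = 4`, TIER 2 (`κ = log 6/5`), GIVEN H1, H2′: AFFINE RADIUS `ε(β_W) = 0.35 − 0.42β_W` on `0 ≤ β_W ≤ 5/6`** (weighted pair door on P35;
vanishing at `5/6`; certificate max `0.974`). [folklore] -/
theorem su3_areaLawOnBallW_affineRadius'_w65 (hP : OneLinkPoincareSUN 3 (3 / 5) (4 / 5)) (hV : OneLinkVarianceBound 3 (3 / 5) (17 / 5))
    {βW : ℝ} (hβ0 : 0 ≤ βW) (hβ : βW ≤ 5 / 6) {mv : ℕ} (hmv : 1 ≤ mv) :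
    AreaLawOnBallW 3 4 (βW / 3) (Real.log (6 / 5)) (2 * (7 / 20 - 21 / 50 * βW)) (7 / 20 - 21 / 50 * βW) mv :=
  su3_hsRowW4' hmv hP hV hβ0 (by linarith) (Real.log_pos (by norm_num)) exp_log_six_fifths_div_three_le (by linarith) (by linarith)
    (by nlinarith [mul_nonneg hβ0 (sub_nonneg.2 hβ), pow_nonneg hβ0 2, pow_nonneg hβ0 3, mul_nonneg (pow_nonneg hβ0 2) (sub_nonneg.2 hβ),
      mul_nonneg (pow_nonneg hβ0 3) (sub_nonneg.2 hβ), pow_nonneg hβ0 4, mul_nonneg (pow_nonneg hβ0 4) (sub_nonneg.2 hβ)])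

/-- **`SU(3)`, `d = 3`, TIER 2 (`κ = log 6/5`), GIVEN H1, H2: AFFINE RADIUS `ε(β_W) = 0.45 − β_W/3` on `0 ≤ β_W ≤ 33/40`** (certificate max `0.985`). [folklore] -/
theorem su3_areaLawOnBallW_dim3_affineRadius_w65 (hP : OneLinkPoincareSUN 3 (3 / 5) (4 / 5))
    (hV : OneLinkVarianceBound 3 (11 / 30) (49 / 20)) {βW : ℝ} (hβ0 : 0 ≤ βW) (hβ : βW ≤ 33 / 40) {mv : ℕ} (hmv : 1 ≤ mv) :
    AreaLawOnBallW 3 3 (βW / 3) (Real.log (6 / 5)) (2 * (9 / 20 - βW / 3)) (9 / 20 - βW / 3) mv :=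
  su3_hsRowW3 hmv hP hV hβ0 hβ (Real.log_pos (by norm_num)) exp_log_six_fifths_div_two_le (by linarith) (by linarith)
    (by nlinarith [mul_nonneg hβ0 (sub_nonneg.2 hβ), pow_nonneg hβ0 2, pow_nonneg hβ0 3, mul_nonneg (pow_nonneg hβ0 2) (sub_nonneg.2 hβ),
      mul_nonneg (pow_nonneg hβ0 3) (sub_nonneg.2 hβ), pow_nonneg hβ0 4, mul_nonneg (pow_nonneg hβ0 4) (sub_nonneg.2 hβ)])

/-- **`SU(3)`, `d = 3`, TIER 2 (`κ = log 6/5`), GIVEN H1, H2′: AFFINE RADIUS `ε(β_W) = 0.33 − 0.27β_W` on `0 ≤ β_W ≤ 6/5`** (certificate max `0.981`). [folklore] -/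
theorem su3_areaLawOnBallW_dim3_affineRadius'_w65 (hP : OneLinkPoincareSUN 3 (3 / 5) (4 / 5))
    (hV : OneLinkVarianceBound 3 (3 / 5) (17 / 5)) {βW : ℝ} (hβ0 : 0 ≤ βW) (hβ : βW ≤ 6 / 5) {mv : ℕ} (hmv : 1 ≤ mv) :
    AreaLawOnBallW 3 3 (βW / 3) (Real.log (6 / 5)) (2 * (33 / 100 - 27 / 100 * βW)) (33 / 100 - 27 / 100 * βW) mv :=
  su3_hsRowW3' hmv hP hV hβ0 (by linarith) (Real.log_pos (by norm_num)) exp_log_six_fifths_div_two_le (by linarith) (by linarith)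
    (by nlinarith [mul_nonneg hβ0 (sub_nonneg.2 hβ), pow_nonneg hβ0 2, pow_nonneg hβ0 3, mul_nonneg (pow_nonneg hβ0 2) (sub_nonneg.2 hβ),
      mul_nonneg (pow_nonneg hβ0 3) (sub_nonneg.2 hβ), pow_nonneg hβ0 4, mul_nonneg (pow_nonneg hβ0 4) (sub_nonneg.2 hβ)])

end Summit.Ventures.YMGap.RobustBallPair

end
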